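import Mathlib
import Summits.CriticalPhenomena.PercolationContinuityZ3.Theorems.PercNearOneGluingNoHeavyLowerTailKnQuestion8AntitheticTower

/-!
# The source tower calculus, II: the full four-set calculus and the world reduction

Support file (seat `prim-ineq-gen-7` gen 31; helper for `stmt-CriticalPhenomena-4575`).  No `sorry`; nothing about the crux is asserted.
Memo: run/shared/lean/prim/prim-ineq-gen-7/FINDING-TOWER-g31.md §1, §4a and PROOF-TOWER-g31.md §3 (worlds).

The full calculus of the antithetic tower has four membership/route bits (`a, a', b, b'`); `cert4` is the certificate predicate of the
localized pure functional (type 1 ∨ type 2); `T4`, `m4`, `hands4` repeat the recursion of part I.  Under the W-rule of a level, a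
configuration lives in one of three worlds: DEAD (memberships meet both route pairs: `T4_dead`, `m4_dead`), PLAIN (no own routes:
`T4_plain`, `m4_plain`), or TYPE `t` (own routes inside one pair, memberships touching it: `T4_world`, `m4_world` reduce to the monochrome
calculus of part I via the projection `prD`).

* `AntitheticTower.T4_world`, `m4_world`, `T4_plain`, `m4_plain`, `T4_dead`, `m4_dead`.
-/

namespace Summit.CriticalPhenomena.PercolationContinuityZ3.Theorems

namespace AntitheticTower


/-! ## The full four-set calculus, the world reduction, and HUB_k / BASE_k for all k

The FULL calculus has four membership/route bits (`a, a', b, b'`), `cert4 r s` = type-1 ∨ type-2 certificate, and the same recursion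
(`T4`, `m4`, `hands4`).  Under the W-RULE of a level (every membership vector contains the union `Λ` of all own routes) a level lives in
one of three WORLDS: dead (`Λ` meets both route pairs: every value vanishes, `T4_dead`), plain (`Λ = 0`: `T4_plain`, `m4_plain`), or
type `t` (`Λ` inside one route pair: `T4_world`, `m4_world` reduce `T4`, `m4` to the monochrome `T`, `m` of the projection).  With the
capacity and value lemmas above this gives, for EVERY level `k`, the 1-slice lemma of the hub step `AntitheticTower.hub` (HUB_k) and the
empty-forest invariant `AntitheticTower.base` (BASE_k) — memo FINDING-TOWER-g31 §4, PROOF-TOWER-g31 §3–§5.  By the (pencil, numerically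
anchored) ⋈/hub identities of the memo these imply L-PURE for every rooted tree of root degree 1.

* `AntitheticTower.hub` — HUB_k for all `k`.      * `AntitheticTower.base` — BASE_k for all `k`.
* `AntitheticTower.T4_world`, `T4_plain`, `T4_dead` — the world reduction. -/


/-- Four membership / route bits: `a, a', b, b'`. -/
structure Q4 where
  /-- bit of the set `a` -/
  a : Bool
  /-- bit of the set `a'` -/
  ap : Bool
  /-- bit of the set `b` -/
  b : Bool
  /-- bit of the set `b'` -/
  bp : Bool
deriving DecidableEq

/-- The empty four-set vector. -/
def Q4.zero : Q4 := ⟨false, false, false, false⟩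

/-- Union of four-set vectors. -/
def Q4.sup (x y : Q4) : Q4 := ⟨x.a || y.a, x.ap || y.ap, x.b || y.b, x.bp || y.bp⟩

/-- Componentwise inclusion, as a Boolean. -/
def Q4.sub (x y : Q4) : Bool := (!x.a || y.a) && (!x.ap || y.ap) && (!x.b || y.b) && (!x.bp || y.bp)

/-- The certificate predicate `cert(r,s)` of the antithetic pure functional (type 1 ∨ type 2). -/
def cert4 (r s : Q4) : Bool := (r.a && !s.ap && !s.b && r.bp) || (r.ap && !s.a && r.b && !s.bp)

/-- The product term `(s_a − s_{a'})(s_b − s_{b'})`. -/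
def prod4 (s : Q4) : ℤ := (bi s.a - bi s.ap) * (bi s.b - bi s.bp)

/-- A source of the full calculus: memberships, own old routes, charge. -/
structure Src4 where
  /-- memberships of the virtual top -/
  s : Q4
  /-- own old routes -/
  l : Q4
  /-- charge -/
  z : Bool
deriving DecidableEq

/-- Configurations of the full calculus. -/
inductive Cfg4 : ℕ → Type
  | nil : Cfg4 0
  | node : {k : ℕ} → Src4 → Cfg4 k → Cfg4 k → Cfg4 (k + 1)

/-- Handed versions of a full source. -/
def Src4.hands (v : Src4) : List Src4 := [v, ⟨v.s, v.l, false⟩, ⟨v.s, Q4.zero, false⟩]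

/-- Handed versions of a full configuration. -/
def hands4 : (k : ℕ) → Cfg4 k → List (Cfg4 k)
  | 0, .nil => [.nil]
  | k + 1, .node v h t =>
      (v.hands.flatMap fun v' => (hands4 k h).flatMap fun h' => (hands4 k t).map fun t' => Cfg4.node v' h' t')

/-- The full tower value `T_k(r; s, z; D)`. -/
def T4 : (k : ℕ) → Q4 → Q4 → Bool → Cfg4 k → ℤ
  | 0, r, s, z, .nil => bi (z && cert4 r s)
  | k + 1, r, s, z, .node v h t =>
      T4 k (Q4.sup r v.l) s z h + T4 k r v.s v.z t - lmin ((hands4 k t).map fun t' => T4 k v.l v.s v.z t')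

/-- Minimum of the full value over handed versions. -/
def m4 (k : ℕ) (r s : Q4) (z : Bool) (D : Cfg4 k) : ℤ := lmin ((hands4 k D).map fun D' => T4 k r s z D')

/-- A Boolean predicate holds for every source of a configuration. -/
def alls : (k : ℕ) → Cfg4 k → (Src4 → Bool) → Bool
  | 0, .nil, _ => true
  | k + 1, .node v h t, p => p v && alls k h p && alls k t p

/-- Union of the own routes of all sources. -/
def lamU4 : (k : ℕ) → Cfg4 k → Q4
  | 0, .nil => Q4.zero
  | k + 1, .node v h t => Q4.sup v.l (Q4.sup (lamU4 k h) (lamU4 k t))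

/-- Every full configuration has a handed version. -/
theorem hands4_ne_nil : ∀ (k : ℕ) (D : Cfg4 k), hands4 k D ≠ []
  | 0, .nil => by simp [hands4]
  | k + 1, .node v h t => by
      obtain ⟨h', hh'⟩ := List.exists_mem_of_ne_nil _ (hands4_ne_nil k h)
      obtain ⟨t', ht'⟩ := List.exists_mem_of_ne_nil _ (hands4_ne_nil k t)
      apply List.ne_nil_of_mem (a := Cfg4.node v h' t')
      simp only [hands4, List.mem_flatMap, List.mem_map, Src4.hands]
      exact ⟨v, by simp, h', hh', t', ht', rfl⟩

/-- The identity handing (full calculus). -/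
theorem self_mem_hands4 : ∀ (k : ℕ) (D : Cfg4 k), D ∈ hands4 k D
  | 0, .nil => by simp [hands4]
  | k + 1, .node v h t => by
      simp only [hands4, List.mem_flatMap, List.mem_map, Src4.hands]
      exact ⟨v, by simp, h, self_mem_hands4 k h, t, self_mem_hands4 k t, rfl⟩

/-- Handings of the parts give a handing of the node (full calculus). -/
theorem node_mem_hands4 {k : ℕ} (v : Src4) {v' : Src4} (hv : v' ∈ v.hands) {h h' t t' : Cfg4 k}
    (hh : h' ∈ hands4 k h) (ht : t' ∈ hands4 k t) : Cfg4.node v' h' t' ∈ hands4 (k + 1) (Cfg4.node v h t) := by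
  simp only [hands4, List.mem_flatMap, List.mem_map]
  exact ⟨v', hv, h', hh, t', ht, rfl⟩

/-- `m4` is attained. -/
theorem m4_attained (k : ℕ) (r s : Q4) (z : Bool) (D : Cfg4 k) : ∃ D' ∈ hands4 k D, m4 k r s z D = T4 k r s z D' := by
  have hne : ((hands4 k D).map fun D' => T4 k r s z D') ≠ [] := by simpa using hands4_ne_nil k D
  have := lmin_mem hne
  simp only [List.mem_map] at this
  obtain ⟨D', hD', hval⟩ := this
  exact ⟨D', hD', by simp [m4, hval]⟩

/-- `m4` is below the value of every handed version. -/
theorem m4_le_of_mem {k : ℕ} {r s : Q4} {z : Bool} {D D' : Cfg4 k} (hD' : D' ∈ hands4 k D) : m4 k r s z D ≤ T4 k r s z D' :=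
  lmin_le_of_mem (List.mem_map.mpr ⟨D', hD', rfl⟩)

/-- A property of sources that is stable under handing a source. -/
def HandStable (p : Src4 → Bool) : Prop := ∀ v : Src4, p v = true → ∀ v' ∈ v.hands, p v' = true

/-- `alls` is preserved by handing for hand-stable predicates. -/
theorem alls_hands {p : Src4 → Bool} (hp : HandStable p) :
    ∀ (k : ℕ) (D D' : Cfg4 k), alls k D p = true → D' ∈ hands4 k D → alls k D' p = true
  | 0, .nil, .nil, _, _ => rfl
  | k + 1, .node v h t, D', hD, hD' => by
      simp only [hands4, List.mem_flatMap, List.mem_map] at hD'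
      obtain ⟨v', hv', h', hh', t', ht', rfl⟩ := hD'
      simp only [alls, Bool.and_eq_true] at hD ⊢
      exact ⟨⟨hp v hD.1.1 v' hv', alls_hands hp k h h' hD.1.2 hh'⟩, alls_hands hp k t t' hD.2 ht'⟩

/-! ### World reduction: type `t` (`t = true`: routes `{a,b'}`; `t = false`: routes `{a',b}`) -/

/-- Projection of a route vector to the two route bits of type `t`. -/
def pr (t : Bool) (r : Q4) : Rt := if t then (r.a, r.bp) else (r.ap, r.b)

/-- Openness of a membership vector for type `t` (no blocker of type `t`). -/
def opn (t : Bool) (s : Q4) : Bool := if t then !(s.ap || s.b) else !(s.a || s.bp)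

/-- A membership vector touches the routes of type `t` (kills the other type). -/
def touch (t : Bool) (s : Q4) : Bool := if t then (s.a || s.bp) else (s.ap || s.b)

/-- A route vector lies inside the routes of type `t`. -/
def inside (t : Bool) (l : Q4) : Bool := if t then (!l.ap && !l.b) else (!l.a && !l.bp)

/-- Pointwise certificate identity in the type-`t` world. -/
theorem cert4_world (t : Bool) (r s : Q4) (hs : touch t s = true) : cert4 r s = (full (pr t r) && opn t s) := by
  rcases r with ⟨r1, r2, r3, r4⟩; rcases s with ⟨s1, s2, s3, s4⟩
  revert hs; cases t <;> cases r1 <;> cases r2 <;> cases r3 <;> cases r4 <;> cases s1 <;> cases s2 <;> cases s3 <;> cases s4 <;> decide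

/-- Projection commutes with union. -/
theorem pr_sup (t : Bool) (x y : Q4) : pr t (Q4.sup x y) = sup (pr t x) (pr t y) := by
  cases t <;> rfl

/-- Projection of the empty vector. -/
theorem pr_zero (t : Bool) : pr t Q4.zero = (false, false) := by cases t <;> rfl

/-- Projection of a source to the monochrome calculus. -/
def prS (t : Bool) (v : Src4) : Src := ⟨opn t v.s, pr t v.l, v.z⟩

/-- Projection of a configuration to the monochrome calculus. -/
def prD (t : Bool) : (k : ℕ) → Cfg4 k → Cfg k
  | 0, .nil => .nil
  | k + 1, .node v h t' => .node (prS t v) (prD t k h) (prD t k t')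

/-- Handed versions of a source project to handed versions of the projected source. -/
theorem prS_hands (t : Bool) (v : Src4) : v.hands.map (prS t) = (prS t v).hands := by
  simp [Src4.hands, Src.hands, prS, pr_zero]

/-- Handed versions project to handed versions. -/
theorem prD_hands (t : Bool) : ∀ (k : ℕ) (D : Cfg4 k), (hands4 k D).map (prD t k) = hands k (prD t k D)
  | 0, .nil => by simp [hands4, hands, prD]
  | k + 1, .node v h t' => by
      simp only [hands4, hands, prD, ← prS_hands, ← prD_hands t k h, ← prD_hands t k t', List.map_flatMap, List.flatMap_map,
        List.map_map]
      rfl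

/-- The world hypothesis of type `t` for the sources of a configuration: memberships touch, routes inside. -/
def worldOK (t : Bool) (v : Src4) : Bool := touch t v.s && inside t v.l

/-- `worldOK` is hand-stable. -/
theorem worldOK_stable (t : Bool) : HandStable (worldOK t) := by
  intro v hv v' hv'
  simp only [Src4.hands, List.mem_cons, List.mem_nil_iff, or_false] at hv'
  simp only [worldOK, Bool.and_eq_true] at hv ⊢
  rcases hv' with rfl | rfl | rfl
  · exact hv
  · exact hv
  · refine ⟨hv.1, ?_⟩; cases t <;> simp [inside, Q4.zero]

/-- WORLD REDUCTION: in the type-`t` world the full value is the monochrome value of the projection. -/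
theorem T4_world (t : Bool) : ∀ (k : ℕ) (r s : Q4) (z : Bool) (D : Cfg4 k),
    touch t s = true → alls k D (worldOK t) = true → T4 k r s z D = T k (pr t r) (opn t s) z (prD t k D)
  | 0, r, s, z, .nil, hs, _ => by
      have e : ∀ a b c : Bool, bi (a && (b && c)) = bi (a && c && b) := by decide
      simp only [T4, T, prD, cert4_world t r s hs, e]
  | k + 1, r, s, z, .node v h t', hs, hD => by
      simp only [alls, Bool.and_eq_true, worldOK] at hD
      obtain ⟨⟨⟨hvs, hvl⟩, hh⟩, ht'⟩ := hD
      simp only [T4, T, prD]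
      have e1 := T4_world t k (Q4.sup r v.l) s z h hs hh
      have e2 := T4_world t k r v.s v.z t' hvs ht'
      have e3 : ((hands4 k t').map fun u => T4 k v.l v.s v.z u) = ((hands k (prD t k t')).map fun u => T k (pr t v.l) (opn t v.s) v.z u) := by
        rw [← prD_hands t k t', List.map_map]
        apply List.map_congr_left
        intro u hu
        exact T4_world t k v.l v.s v.z u hvs (alls_hands (worldOK_stable t) k t' u (by simpa [worldOK] using ht') hu)
      rw [e1, e2, e3, pr_sup]
      rfl

/-- World reduction for the minimum over handed versions. -/
theorem m4_world (t : Bool) (k : ℕ) (r s : Q4) (z : Bool) (D : Cfg4 k)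
    (hs : touch t s = true) (hD : alls k D (worldOK t) = true) : m4 k r s z D = m k (pr t r) (opn t s) z (prD t k D) := by
  simp only [m4, m]
  rw [← prD_hands t k D, List.map_map]
  congr 1
  apply List.map_congr_left
  intro u hu
  exact T4_world t k r s z u hs (alls_hands (worldOK_stable t) k D u hD hu)

/-! ### Plain world (no old routes) and dead world -/

/-- No source has own routes. -/
def plain (v : Src4) : Bool := decide (v.l = Q4.zero)

/-- `plain` is hand-stable. -/
theorem plain_stable : HandStable plain := by
  intro v hv v' hv'
  simp only [Src4.hands, List.mem_cons, List.mem_nil_iff, or_false] at hv'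
  simp only [plain, decide_eq_true_eq] at hv ⊢
  rcases hv' with rfl | rfl | rfl
  · exact hv
  · exact hv
  · rfl

/-- Sum of the charged certificates of the sources (plain world). -/
def csum : (k : ℕ) → Q4 → Cfg4 k → ℤ
  | 0, _, .nil => 0
  | k + 1, r, .node v h t => bi (v.z && cert4 r v.s) + csum k r h + csum k r t

/-- `csum ≥ 0`. -/
theorem csum_nonneg : ∀ (k : ℕ) (r : Q4) (D : Cfg4 k), 0 ≤ csum k r D
  | 0, _, .nil => le_refl _
  | k + 1, r, .node v h t => by
      simp only [csum]; have := bi_nonneg (v.z && cert4 r v.s); have := csum_nonneg k r h; have := csum_nonneg k r t; omega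

/-- No certificates through the empty route set. -/
theorem cert4_zero (s : Q4) : cert4 Q4.zero s = false := by simp [cert4, Q4.zero]

/-- `csum` through the empty route set vanishes. -/
theorem csum_zero : ∀ (k : ℕ) (D : Cfg4 k), csum k Q4.zero D = 0
  | 0, .nil => rfl
  | k + 1, .node v h t => by simp [csum, cert4_zero, csum_zero k h, csum_zero k t]

/-- Union with the empty vector. -/
theorem Q4.sup_zero (r : Q4) : Q4.sup r Q4.zero = r := by cases r; simp [Q4.sup, Q4.zero]

/-- `lmin` of a constant-zero nonempty image is 0. -/
theorem lmin_const_zero {α : Type} (l : List α) (f : α → ℤ) (hl : l ≠ []) (hf : ∀ x ∈ l, f x = 0) : lmin (l.map f) = 0 := by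
  have hne : l.map f ≠ [] := by simpa using hl
  have h1 := lmin_mem hne
  simp only [List.mem_map] at h1
  obtain ⟨x, hx, hv⟩ := h1
  rw [← hv, hf x hx]

/-- PLAIN WORLD: the value is the root certificate plus the charged source certificates. -/
theorem T4_plain : ∀ (k : ℕ) (r s : Q4) (z : Bool) (D : Cfg4 k), alls k D plain = true →
    T4 k r s z D = bi (z && cert4 r s) + csum k r D
  | 0, r, s, z, .nil, _ => by simp [T4, csum]
  | k + 1, r, s, z, .node v h t, hD => by
      simp only [alls, Bool.and_eq_true, plain, decide_eq_true_eq] at hD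
      obtain ⟨⟨hv, hh⟩, ht⟩ := hD
      simp only [T4, csum, hv, Q4.sup_zero]
      rw [T4_plain k r s z h hh, T4_plain k r v.s v.z t ht]
      have hz : lmin ((hands4 k t).map fun t' => T4 k Q4.zero v.s v.z t') = 0 := by
        apply lmin_const_zero _ _ (hands4_ne_nil k t)
        intro u hu
        rw [T4_plain k Q4.zero v.s v.z u (alls_hands plain_stable k t u ht hu), cert4_zero, csum_zero]; simp
      rw [hz]; ring

/-- The charge-dropped version of a configuration (memberships and routes kept). -/
def dropz : (k : ℕ) → Cfg4 k → Cfg4 k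
  | 0, .nil => .nil
  | k + 1, .node v h t => .node ⟨v.s, v.l, false⟩ (dropz k h) (dropz k t)

/-- The charge-dropped version is a handed version. -/
theorem dropz_mem : ∀ (k : ℕ) (D : Cfg4 k), dropz k D ∈ hands4 k D
  | 0, .nil => by simp [hands4, dropz]
  | k + 1, .node v h t => by
      simp only [dropz]; exact node_mem_hands4 v (by simp [Src4.hands]) (dropz_mem k h) (dropz_mem k t)

/-- `csum` of a charge-dropped configuration vanishes. -/
theorem csum_dropz : ∀ (k : ℕ) (r : Q4) (D : Cfg4 k), csum k r (dropz k D) = 0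
  | 0, _, .nil => rfl
  | k + 1, r, .node v h t => by simp [csum, dropz, csum_dropz k r h, csum_dropz k r t]

/-- PLAIN WORLD: the minimum over handed versions is the root certificate. -/
theorem m4_plain (k : ℕ) (r s : Q4) (z : Bool) (D : Cfg4 k) (hD : alls k D plain = true) :
    m4 k r s z D = bi (z && cert4 r s) := by
  apply le_antisymm
  · have h1 := m4_le_of_mem (r := r) (s := s) (z := z) (dropz_mem k D)
    rw [T4_plain k r s z _ (alls_hands plain_stable k D _ hD (dropz_mem k D)), csum_dropz] at h1
    simpa using h1
  · obtain ⟨D', hD', hval⟩ := m4_attained k r s z D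
    rw [hval, T4_plain k r s z D' (alls_hands plain_stable k D D' hD hD')]
    have := csum_nonneg k r D'; omega

/-- All memberships of the sources are closed for both types (dead world) / generally: no certificate at any source. -/
def nocert (v : Src4) : Bool := touch true v.s && touch false v.s

/-- `nocert` is hand-stable. -/
theorem nocert_stable : HandStable nocert := by
  intro v hv v' hv'
  simp only [Src4.hands, List.mem_cons, List.mem_nil_iff, or_false] at hv'
  rcases hv' with rfl | rfl | rfl <;> exact hv

/-- A membership vector touching both types admits no certificate. -/
theorem cert4_dead (r s : Q4) (h1 : touch true s = true) (h2 : touch false s = true) : cert4 r s = false := by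
  rcases r with ⟨r1, r2, r3, r4⟩; rcases s with ⟨s1, s2, s3, s4⟩
  revert h1 h2; cases r1 <;> cases r2 <;> cases r3 <;> cases r4 <;> cases s1 <;> cases s2 <;> cases s3 <;> cases s4 <;> decide

/-- DEAD WORLD: every value vanishes. -/
theorem T4_dead : ∀ (k : ℕ) (r s : Q4) (z : Bool) (D : Cfg4 k), touch true s = true → touch false s = true →
    alls k D nocert = true → T4 k r s z D = 0
  | 0, r, s, z, .nil, h1, h2, _ => by simp [T4, cert4_dead r s h1 h2]
  | k + 1, r, s, z, .node v h t, h1, h2, hD => by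
      simp only [alls, Bool.and_eq_true, nocert] at hD
      obtain ⟨⟨⟨hv1, hv2⟩, hh⟩, ht⟩ := hD
      simp only [T4]
      rw [T4_dead k _ s z h h1 h2 hh, T4_dead k r v.s v.z t hv1 hv2 ht]
      have hz : lmin ((hands4 k t).map fun t' => T4 k v.l v.s v.z t') = 0 := by
        apply lmin_const_zero _ _ (hands4_ne_nil k t)
        intro u hu
        exact T4_dead k v.l v.s v.z u hv1 hv2 (alls_hands nocert_stable k t u (by simpa [nocert] using ht) hu)
      rw [hz]; simp

/-- DEAD WORLD: the minimum vanishes too. -/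
theorem m4_dead (k : ℕ) (r s : Q4) (z : Bool) (D : Cfg4 k) (h1 : touch true s = true) (h2 : touch false s = true)
    (hD : alls k D nocert = true) : m4 k r s z D = 0 := by
  obtain ⟨D', hD', hval⟩ := m4_attained k r s z D
  rw [hval, T4_dead k r s z D' h1 h2 (alls_hands nocert_stable k D D' hD hD')]


end AntitheticTower

end Summit.CriticalPhenomena.PercolationContinuityZ3.Theorems
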